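import Literature.NumberTheory.Automorphic.UnitaryThreeTorusBlockElements        -- ★ γ2b-A p841504 (+ γ2a, γ0, B-p04 p841018, (F1))
import Literature.NumberTheory.Automorphic.UnitaryThreeDoubleCosetsHKDefs         -- ★ B-p17 DEFS: `flickerKH`
import HarnessLib

/-!
# Flicker's Proposition 6 (b), RAMIFIED torus, in the `U(Φ₃)` frame: the double cosets `T_H · r_n · K_H` are pairwise distinct
(Flicker (1998), *Elementary proof of the fundamental lemma for a unitary group*, Prop. 6 (second half) p. 83: `H = ⊔_j T_H r_j K_H`,
`r_j = (0 1;1 0)^j(…)`, for the type-(2) torus `T_H ≅ (EL)¹`, `L∕F` ramified)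

Topic `NumberTheory/Automorphic`; namespace `Literature.NumberTheory.Automorphic.UnitaryGroup`.  KERNEL mathematics only: theorems, no definition, no
named fact, no instance, no notation, no `sorry`.  Cell `pub/hodgecm-mathlib`, programme P3a, road «D-N7-inert», MAP v3 «N7-ns COUNT FROM FLICKER», brick
γ2′ «THE RAMIFIED ∕ TYPE-(2) TRANSPORT» (LEAD F0P3a-plan (g9) T8-84 (2); B-p04 (g33)'s suggestion; consumer: A-p03 (g24)'s `B_H` adapter and B-p04's
★ p840967 `FixedPointsTorusDoubleCosetCount` at the type-(2) torus) — FILE `hB′` (disjointness; valuations only, no lattice).  HC_CM is proved only modulo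
the printed citations (2 remaining named inputs hLiu418, h413) until rung 0 closes; this file discharges no named fact.

MATHEMATICS.  `t′ = !![A,0,B;0,b₀,0;C,0,A] ∈ H` a regular RAMIFIED torus block: `C ≠ 0` and `B = C·ρ` with `|ρ| = |ϖ|` (odd valuation; for Flicker's
`w = (0, π∕√D; √D, 0)`, `ρ = π∕D`).  `Z_H(t′)` = blocks `!![p, 0, ρq; 0, e, 0; q, 0, p]` (★ `mem_centralizer_block_iff`) and unitarity forces **`|p| = 1`**
(`|p² − ρq²| = 1` with `|ρq²|` of odd valuation).  Two families of representatives (the parity of the `L`-valuation): **`r(2a) = diag(ϖ^{−a}, 1, ϖ^{a})`**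
and **`r(2a+1)` with corner `(0, ϖ^{a+1}∕d; −d·ϖ^{−(a+1)}, 0)`** (`σd = −d`, `|d| = 1`; Flicker's `t_j = (0 1;1 0)^j`).  If `τ r_m k = τ′ r_n k′` then
`r_m = σ₀ r_n κ`, `σ₀ ∈ Z_H(t′)`, `κ ∈ K_H` (integral corner `(a b; c e)`, `|ae − bc| = 1`), and reading two corner entries of the block product gives in
each of the four parity cases either `m = n` (`|a| = |ϖ|^{b−a} ≤ 1`, `|e| = |ϖ|^{a−b} ≤ 1`) or an entry of `κ` of valuation `|ϖ|^{−(a+b+1)} > 1` —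
contradiction.  Hence `m = n`: the binder `hB` of ★ p840967 at the type-(2) torus.

References: [Flicker1998UnitaryFL] Y. Z. Flicker, Canad. J. Math. 50 (1998), Prop. 6 p. 83 · [Rogawski1990] J. D. Rogawski, Ann. of Math. Stud. 123, §4.9 p. 55. -/

set_option autoImplicit false

open Matrix
open scoped MatrixGroups WithZero

namespace Literature.NumberTheory.Automorphic.UnitaryGroup

open Literature.NumberTheory.Automorphic.HermitianLattice (unitaryInt LocalConjDatum)

variable {K : Type*} [Field K] [Valued K ℤᵐ⁰] {ϖ : K} (σ : K →+* K) {J : Matrix (Fin 3) (Fin 3) K}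
  (hJ : J = (StdForm.antidiagonal 3).over K) (hd : LocalConjDatum σ ϖ)

/-- In `ℤᵐ⁰`: `x·x = 1 ⇒ x = 1`. [folklore] -/
private theorem eq_one_of_mul_self'' {x : ℤᵐ⁰} (h : x * x = 1) : x = 1 := by
  have hx0 : x ≠ 0 := fun h0 => by rw [h0, zero_mul] at h; exact zero_ne_one h
  rw [← WithZero.exp_log hx0, ← WithZero.exp_add, ← WithZero.exp_zero, WithZero.exp_inj] at h
  rw [← WithZero.exp_log hx0, ← WithZero.exp_zero, WithZero.exp_inj]; omega

include hd in
/-- **`|p| = 1` on the ramified torus**: if `(p² − ρq²)·σ(p² − ρq²) = 1`-type norm condition gives `|p·p − ρ·q·q| = 1` and `|ρ| = |ϖ|` (odd), then `|p| = 1`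
(the `q`-term has odd valuation, so it can neither cancel `p²` nor be a unit). [cite: Flicker1998UnitaryFL, Prop. 6 p. 83] -/
theorem v_eq_one_of_v_sub_eq_one {p q ρ : K} (hρ : Valued.v ρ = Valued.v ϖ) (h : Valued.v (p * p - ρ * q * q) = 1) : Valued.v p = 1 := by
  have hvϖ := hd.vϖ
  by_cases hq : q = 0
  · rw [hq, mul_zero, sub_zero, map_mul] at h; exact eq_one_of_mul_self'' h
  have hvq0 : Valued.v q ≠ 0 := (Valuation.ne_zero_iff _).2 hq
  -- `|ρ q q| = exp(2 log|q| − 1)` is never `exp` of an even integer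
  have hodd : ∀ n : ℤ, Valued.v (ρ * q * q) ≠ WithZero.exp (2 * n) := by
    intro n hn
    rw [map_mul, map_mul, hρ, hvϖ, ← WithZero.exp_log hvq0, ← WithZero.exp_add, ← WithZero.exp_add, WithZero.exp_inj] at hn
    omega
  by_cases hp : p = 0
  · exfalso
    rw [hp, mul_zero, zero_sub, Valuation.map_neg] at h
    exact hodd 0 (by rw [h, mul_zero, WithZero.exp_zero])
  have hvp0 : Valued.v p ≠ 0 := (Valuation.ne_zero_iff _).2 hp
  have hne : Valued.v (p * p) ≠ Valued.v (-(ρ * q * q)) := by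
    rw [Valuation.map_neg, map_mul, ← WithZero.exp_log hvp0, ← WithZero.exp_add]
    intro h1
    exact hodd (WithZero.log (Valued.v p)) (by rw [← h1]; congr 1; ring)
  have hmax := Valuation.map_add_of_distinct_val _ hne
  rw [← sub_eq_add_neg, h, Valuation.map_neg] at hmax
  -- `1 = max (|p|², |ρq²|)`; the second is not `1`
  rcases le_total (Valued.v (p * p)) (Valued.v (ρ * q * q)) with hle | hle
  · rw [max_eq_right hle] at hmax
    exact absurd hmax.symm (by have := hodd 0; rwa [mul_zero, WithZero.exp_zero] at this)
  · rw [max_eq_left hle, map_mul] at hmax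
    exact eq_one_of_mul_self'' hmax.symm

/-- Exponent bookkeeping (i): `|x| ≤ 1` and `|x|·|ϖ^a| = |ϖ^b|` force `a ≤ b`. [cite: Flicker1998UnitaryFL, Prop. 6 p. 83] -/
theorem le_of_v_mul_pow_eq {x : K} (hϖ : Valued.v ϖ = WithZero.exp (-1 : ℤ)) (hx : Valued.v x ≤ 1) {a b : ℕ}
    (h : Valued.v x * Valued.v (ϖ ^ a) = Valued.v (ϖ ^ b)) : a ≤ b := by
  have hx0 : Valued.v x ≠ 0 := by
    intro h0; rw [h0, zero_mul, map_pow, hϖ, ← WithZero.exp_nsmul] at h; exact WithZero.exp_ne_zero h.symm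
  rw [map_pow, map_pow, hϖ, ← WithZero.exp_nsmul, ← WithZero.exp_nsmul, ← WithZero.exp_log hx0, ← WithZero.exp_add, WithZero.exp_inj] at h
  rw [← WithZero.exp_log hx0, ← WithZero.exp_zero, WithZero.exp_le_exp] at hx
  simp only [nsmul_eq_mul, mul_neg, mul_one] at h
  omega

/-- Exponent bookkeeping (ii): `|x| ≤ 1` and `|x|·|ϖ^a| = |ϖ^b|⁻¹` with `a + b ≥ 1` is impossible. [cite: Flicker1998UnitaryFL, Prop. 6 p. 83] -/
theorem false_of_v_mul_pow_eq_inv {x : K} (hϖ : Valued.v ϖ = WithZero.exp (-1 : ℤ)) (hx : Valued.v x ≤ 1) {a b : ℕ} (hab : 1 ≤ a + b)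
    (h : Valued.v x * Valued.v (ϖ ^ a) = (Valued.v (ϖ ^ b))⁻¹) : False := by
  have hx0 : Valued.v x ≠ 0 := by
    intro h0; rw [h0, zero_mul, map_pow, hϖ, ← WithZero.exp_nsmul, ← WithZero.exp_neg] at h; exact WithZero.exp_ne_zero h.symm
  rw [map_pow, map_pow, hϖ, ← WithZero.exp_nsmul, ← WithZero.exp_nsmul, ← WithZero.exp_neg, ← WithZero.exp_log hx0, ← WithZero.exp_add,
    WithZero.exp_inj] at h
  rw [← WithZero.exp_log hx0, ← WithZero.exp_zero, WithZero.exp_le_exp] at hx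
  simp only [nsmul_eq_mul, mul_neg, mul_one, neg_neg] at h
  omega

set_option maxHeartbeats 1600000 in
-- explicit block computation in four parity cases
include hJ hd in
/-- **FLICKER'S PROPOSITION 6 (b), RAMIFIED TORUS — THE DOUBLE COSETS `T_H · r_n · K_H` ARE PAIRWISE DISTINCT** (`T_H = Z_H(t′)` for a regular ramified torus
block `t′ = !![A,0,B;0,b₀,0;C,0,A]`, `C ≠ 0`, `B = Cρ`, `|ρ| = |ϖ|`; representatives `r(2a) = diag(ϖ^{−a},1,ϖ^{a})`, `r(2a+1)` with corner
`(0, ϖ^{a+1}∕d; −dϖ^{−(a+1)}, 0)`): `τ r_m k = τ′ r_n k′ ⇒ m = n` — the binder `hB` of ★ `FixedPointsTorusDoubleCosetCount` at the type-(2) torus, VERBATIM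
at `G := ↥H`. [cite: Flicker1998UnitaryFL, Prop. 6 p. 83] -/
theorem eq_of_centralizer_mul_ramifiedRep_mul_flickerKH_eq
    {c : ↥(unitaryGroupOfForm σ J)} (hc : ((c : GL (Fin 3) K) : Matrix (Fin 3) (Fin 3) K) = !![1, 0, 0; 0, -1, 0; 0, 0, 1])
    {d ρ : K} (hvd : Valued.v d = 1) (hρ : Valued.v ρ = Valued.v ϖ)
    {t : ↥(unitaryGroupOfForm σ J)} (htH : t ∈ Subgroup.centralizer ({c} : Set ↥(unitaryGroupOfForm σ J))) {A B C b₀ : K}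
    (hte : ((t : GL (Fin 3) K) : Matrix (Fin 3) (Fin 3) K) = !![A, 0, B; 0, b₀, 0; C, 0, A]) (hC : C ≠ 0) (hBC : B = C * ρ)
    (r : ℕ → ↥(Subgroup.centralizer ({c} : Set ↥(unitaryGroupOfForm σ J))))
    (hr0 : ∀ a : ℕ, (((r (2 * a) : ↥(unitaryGroupOfForm σ J)) : GL (Fin 3) K) : Matrix (Fin 3) (Fin 3) K) =
      !![(ϖ ^ a)⁻¹, 0, 0; 0, 1, 0; 0, 0, ϖ ^ a])
    (hr1 : ∀ a : ℕ, (((r (2 * a + 1) : ↥(unitaryGroupOfForm σ J)) : GL (Fin 3) K) : Matrix (Fin 3) (Fin 3) K) =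
      !![0, 0, ϖ ^ (a + 1) / d; 0, 1, 0; -d * (ϖ ^ (a + 1))⁻¹, 0, 0]) :
    ∀ m n : ℕ, ∀ τ ∈ Subgroup.centralizer ({⟨t, htH⟩} : Set ↥(Subgroup.centralizer ({c} : Set ↥(unitaryGroupOfForm σ J)))),
      ∀ τ' ∈ Subgroup.centralizer ({⟨t, htH⟩} : Set ↥(Subgroup.centralizer ({c} : Set ↥(unitaryGroupOfForm σ J)))),
      ∀ k ∈ (flickerKH σ J c).subgroupOf (Subgroup.centralizer ({c} : Set ↥(unitaryGroupOfForm σ J))),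
      ∀ k' ∈ (flickerKH σ J c).subgroupOf (Subgroup.centralizer ({c} : Set ↥(unitaryGroupOfForm σ J))),
      τ * r m * k = τ' * r n * k' → m = n := by
  intro m n τ hτ τ' hτ' k hk k' hk' heq
  classical
  have h2 : (2 : K) ≠ 0 := fun h0 => by have := hd.v2; rw [h0, map_zero] at this; exact zero_ne_one this
  have hϖ0 : ϖ ≠ 0 := fun h0 => by have := hd.vϖ; rw [h0, map_zero] at this; exact WithZero.zero_ne_coe this
  have hvϖ := hd.vϖ
  -- `σ₀ := τ⁻¹ τ′`, `κ := k′ k⁻¹`, `r_m = σ₀ r_n κ`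
  set σ₀ : ↥(Subgroup.centralizer ({c} : Set ↥(unitaryGroupOfForm σ J))) := τ⁻¹ * τ' with hσ₀
  set κ : ↥(Subgroup.centralizer ({c} : Set ↥(unitaryGroupOfForm σ J))) := k' * k⁻¹ with hκ
  have hrel : r m = σ₀ * r n * κ := by
    rw [hσ₀, hκ]
    have : τ⁻¹ * (τ * r m * k) * k⁻¹ = τ⁻¹ * (τ' * r n * k') * k⁻¹ := by rw [heq]
    simpa [mul_assoc, mul_inv_cancel_left, inv_mul_cancel_left] using this
  have hσ₀Z : σ₀ ∈ (Subgroup.centralizer ({⟨t, htH⟩} : Set ↥(Subgroup.centralizer ({c} : Set ↥(unitaryGroupOfForm σ J))))) := Subgroup.mul_mem _ (Subgroup.inv_mem _ hτ) hτ'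
  have hκK : κ ∈ (flickerKH σ J c).subgroupOf (Subgroup.centralizer ({c} : Set ↥(unitaryGroupOfForm σ J))) := Subgroup.mul_mem _ hk' (Subgroup.inv_mem _ hk)
  -- block shapes
  obtain ⟨p, β₀, q, δ₀, e₀, hσ₀M⟩ := exists_coe_eq_block_of_mem_centralizer σ h2 hc (σ₀ : ↥(Subgroup.centralizer ({c} : Set ↥(unitaryGroupOfForm σ J)))).2
  obtain ⟨aκ, bκ, cκ, eκ, e₂, hκM⟩ := exists_coe_eq_block_of_mem_centralizer σ h2 hc (κ : ↥(Subgroup.centralizer ({c} : Set ↥(unitaryGroupOfForm σ J)))).2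
  have hσ₀t : (σ₀ : ↥(unitaryGroupOfForm σ J)) ∈ Subgroup.centralizer ({t} : Set ↥(unitaryGroupOfForm σ J)) := by
    rw [Subgroup.mem_centralizer_singleton_iff]
    exact congrArg Subtype.val (Subgroup.mem_centralizer_singleton_iff.1 hσ₀Z)
  obtain ⟨hpδ, hβq⟩ := (mem_centralizer_block_iff σ hσ₀M hte hC).1 hσ₀t
  have hβ₀ : β₀ = ρ * q := mul_right_cancel₀ hC (by rw [hβq, hBC]; ring)
  -- `κ ∈ K_H`: integral entries; `|Δ| = 1`; `|p| = 1`
  have hκK' := Subgroup.mem_subgroupOf.1 hκK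
  rw [mem_flickerKH_iff] at hκK'
  have hκint := (mem_unitaryInt_iff_forall_v_apply_le_one σ hJ hd.vσ _).1 hκK'.2
  have hva : Valued.v aκ ≤ 1 := by have := hκint 0 0; rwa [hκM] at this
  have hve : Valued.v eκ ≤ 1 := by have := hκint 2 2; rwa [hκM] at this
  have hvc : Valued.v cκ ≤ 1 := by have := hκint 2 0; rwa [hκM] at this
  have hvdet : ∀ {h : GL (Fin 3) K} {α β γ δ e : K}, h ∈ unitaryGroupOfForm σ ((StdForm.antidiagonal 3).over K) →
      (h : Matrix (Fin 3) (Fin 3) K) = !![α, 0, β; 0, e, 0; γ, 0, δ] → Valued.v (α * δ - β * γ) = 1 := by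
    intro h α β γ δ e hh3 hh
    obtain ⟨⟨R1, R2, R3, R4⟩, -⟩ := SplitDictionary.rel_of_coe_eq_block σ hh3 hh
    have h1 := congrArg Valued.v (SplitDictionary.det_mul_map_det σ R1 R2 R3 R4)
    rw [map_mul, hd.vσ, map_one] at h1
    exact eq_one_of_mul_self'' h1
  have hκ3 : (((κ : ↥(Subgroup.centralizer ({c} : Set ↥(unitaryGroupOfForm σ J)))) : ↥(unitaryGroupOfForm σ J)) : GL (Fin 3) K) ∈ unitaryGroupOfForm σ ((StdForm.antidiagonal 3).over K) := by
    rw [← hJ]; exact ((κ : ↥(Subgroup.centralizer ({c} : Set ↥(unitaryGroupOfForm σ J)))) : ↥(unitaryGroupOfForm σ J)).2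
  have hσ₀3 : (((σ₀ : ↥(Subgroup.centralizer ({c} : Set ↥(unitaryGroupOfForm σ J)))) : ↥(unitaryGroupOfForm σ J)) : GL (Fin 3) K) ∈ unitaryGroupOfForm σ ((StdForm.antidiagonal 3).over K) := by
    rw [← hJ]; exact ((σ₀ : ↥(Subgroup.centralizer ({c} : Set ↥(unitaryGroupOfForm σ J)))) : ↥(unitaryGroupOfForm σ J)).2
  have hvΔ : Valued.v (aκ * eκ - bκ * cκ) = 1 := hvdet hκ3 hκM
  have hvp : Valued.v p = 1 := by
    have h1 : Valued.v (p * δ₀ - β₀ * q) = 1 := hvdet hσ₀3 hσ₀M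
    rw [← hpδ, hβ₀] at h1
    exact v_eq_one_of_v_sub_eq_one σ hd hρ h1
  -- the matrix equation
  have hM : (((r m : ↥(unitaryGroupOfForm σ J)) : GL (Fin 3) K) : Matrix (Fin 3) (Fin 3) K) =
      (((σ₀ : ↥(Subgroup.centralizer ({c} : Set ↥(unitaryGroupOfForm σ J)))) : ↥(unitaryGroupOfForm σ J)) : GL (Fin 3) K) *
        (((r n : ↥(unitaryGroupOfForm σ J)) : GL (Fin 3) K) : Matrix (Fin 3) (Fin 3) K) *
        (((κ : ↥(Subgroup.centralizer ({c} : Set ↥(unitaryGroupOfForm σ J)))) : ↥(unitaryGroupOfForm σ J)) : GL (Fin 3) K) := by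
    rw [← Units.val_mul, ← Units.val_mul, ← Subgroup.coe_mul, ← Subgroup.coe_mul, ← Subgroup.coe_mul, ← Subgroup.coe_mul, ← hrel]
  rw [hσ₀M, hκM, ← hpδ, hβ₀] at hM
  have hϖpow : ∀ k : ℕ, ϖ ^ k ≠ 0 := fun k => pow_ne_zero _ hϖ0
  have hvY : ∀ k : ℕ, Valued.v (-d * (ϖ ^ (k + 1))⁻¹) = (Valued.v (ϖ ^ (k + 1)))⁻¹ := by
    intro k; rw [map_mul, Valuation.map_neg, hvd, one_mul, map_inv₀]
  have hvX : ∀ k : ℕ, Valued.v (ϖ ^ (k + 1) / d) = Valued.v (ϖ ^ (k + 1)) := by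
    intro k; rw [map_div₀, hvd, div_one]
  -- parity cases
  obtain ⟨a, hm⟩ := Nat.even_or_odd' m
  obtain ⟨b, hn⟩ := Nat.even_or_odd' n
  rcases hm with rfl | rfl <;> rcases hn with rfl | rfl
  · -- (even, even)
    rw [hr0 a, hr0 b, block_mul_block, block_mul_block] at hM
    have E00 := congrArg (fun M : Matrix (Fin 3) (Fin 3) K => M 0 0) hM
    have E02 := congrArg (fun M : Matrix (Fin 3) (Fin 3) K => M 0 2) hM
    have E20 := congrArg (fun M : Matrix (Fin 3) (Fin 3) K => M 2 0) hM
    have E22 := congrArg (fun M : Matrix (Fin 3) (Fin 3) K => M 2 2) hM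
    simp at E00 E02 E20 E22
    have hb0 := hϖpow b; have ha0 := hϖpow a
    field_simp at E00 E02 E20 E22
    -- `aκ ϖ^a = ϖ^b p Δ` and `eκ ϖ^b = ϖ^a p Δ`
    have hA : aκ * ϖ ^ a = ϖ ^ b * p * (aκ * eκ - bκ * cκ) := by
      refine mul_right_cancel₀ hb0 ?_
      linear_combination aκ * E22 - bκ * E20
    have hE : eκ * ϖ ^ b = ϖ ^ a * p * (aκ * eκ - bκ * cκ) := by
      linear_combination eκ * E00 - (cκ * ϖ ^ a) * E02
    have h1 := congrArg Valued.v hA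
    have h2' := congrArg Valued.v hE
    simp only [map_mul, hvp, hvΔ, mul_one] at h1 h2'
    have := le_of_v_mul_pow_eq hvϖ hva h1
    have := le_of_v_mul_pow_eq hvϖ hve h2'
    omega
  · -- (even m, odd n): the entry `cκ` has valuation `> 1`
    exfalso
    rw [hr0 a, hr1 b, block_mul_block, block_mul_block] at hM
    have E20 := congrArg (fun M : Matrix (Fin 3) (Fin 3) K => M 2 0) hM
    have E22 := congrArg (fun M : Matrix (Fin 3) (Fin 3) K => M 2 2) hM
    simp at E20 E22
    have hCrel : -(cκ * ϖ ^ a) = p * (-d * (ϖ ^ (b + 1))⁻¹) * (aκ * eκ - bκ * cκ) := by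
      linear_combination (-cκ) * E22 + eκ * E20
    have h1 := congrArg Valued.v hCrel
    simp only [Valuation.map_neg, map_mul, map_inv₀, hvp, hvΔ, hvd, one_mul, mul_one] at h1
    exact false_of_v_mul_pow_eq_inv hvϖ hvc (by omega) h1
  · -- (odd m, even n)
    exfalso
    rw [hr1 a, hr0 b, block_mul_block, block_mul_block] at hM
    have E00 := congrArg (fun M : Matrix (Fin 3) (Fin 3) K => M 0 0) hM
    have E02 := congrArg (fun M : Matrix (Fin 3) (Fin 3) K => M 0 2) hM
    simp at E00 E02
    have hCrel : -(cκ * (ϖ ^ (a + 1) / d)) = p * (ϖ ^ b)⁻¹ * (aκ * eκ - bκ * cκ) := by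
      linear_combination (-cκ) * E02 + eκ * E00
    have h1 := congrArg Valued.v hCrel
    simp only [Valuation.map_neg, map_mul, map_inv₀, map_div₀, hvp, hvΔ, hvd, one_mul, mul_one, div_one] at h1
    exact false_of_v_mul_pow_eq_inv hvϖ hvc (by omega) h1
  · -- (odd, odd)
    rw [hr1 a, hr1 b, block_mul_block, block_mul_block] at hM
    have E00 := congrArg (fun M : Matrix (Fin 3) (Fin 3) K => M 0 0) hM
    have E02 := congrArg (fun M : Matrix (Fin 3) (Fin 3) K => M 0 2) hM
    have E20 := congrArg (fun M : Matrix (Fin 3) (Fin 3) K => M 2 0) hM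
    have E22 := congrArg (fun M : Matrix (Fin 3) (Fin 3) K => M 2 2) hM
    simp at E00 E02 E20 E22
    have hE : eκ * (-d * (ϖ ^ (a + 1))⁻¹) = p * (-d * (ϖ ^ (b + 1))⁻¹) * (aκ * eκ - bκ * cκ) := by
      linear_combination eκ * E20 - cκ * E22
    have hA : aκ * (ϖ ^ (a + 1) / d) = p * (ϖ ^ (b + 1) / d) * (aκ * eκ - bκ * cκ) := by
      linear_combination aκ * E02 - bκ * E00
    have h1 := congrArg Valued.v hE
    have h2' := congrArg Valued.v hA
    simp only [Valuation.map_neg, map_mul, map_inv₀, map_div₀, hvp, hvΔ, hvd, one_mul, mul_one, div_one] at h1 h2'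
    have hA0 : Valued.v (ϖ ^ (a + 1)) ≠ 0 := (Valuation.ne_zero_iff _).2 (hϖpow _)
    have hB0 : Valued.v (ϖ ^ (b + 1)) ≠ 0 := (Valuation.ne_zero_iff _).2 (hϖpow _)
    -- `|eκ| |ϖ^{b+1}| = |ϖ^{a+1}|`
    have h1' : Valued.v eκ * Valued.v (ϖ ^ (b + 1)) = Valued.v (ϖ ^ (a + 1)) := by
      have h3 : Valued.v eκ = (Valued.v (ϖ ^ (b + 1)))⁻¹ * Valued.v (ϖ ^ (a + 1)) := (mul_inv_eq_iff_eq_mul₀ hA0).1 h1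
      rw [h3, mul_comm ((Valued.v (ϖ ^ (b + 1)))⁻¹), mul_assoc, inv_mul_cancel₀ hB0, mul_one]
    have := le_of_v_mul_pow_eq hvϖ hve h1'
    have := le_of_v_mul_pow_eq hvϖ hva h2'
    omega

end Literature.NumberTheory.Automorphic.UnitaryGroup
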